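import Mathlib
import HarnessLib
import Summits.ValiantsHypothesis.ValiantsHypothesis.Theorems.BarrierLeverPartitionMinorsHitByVPHiddenStatesBall
import Summits.ValiantsHypothesis.ValiantsHypothesis.Theorems.BarrierLeverPartitionMinorsHitByVPHiddenStatesSplitRule

/-!
# Route BarrierLever — item `PartitionMinorsHitByVP` (stmt-ValiantsHypothesis-19717):
# the CAPACITY CONJECTURE (hereditary degree capacities suffice) and the item modulo it

Helper file (`--supports stmt-ValiantsHypothesis-19717`; cell valiant-natproofs, rung V4, 𝒟-side of door (c); prover seat
val-np-p3 gen 7). Two Theorems-side `def`s of `Prop`s — a counting predicate and ONE CONJECTURE (the director's standing rule: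
killable conjectures are Theorems-side defs with a falsifier; falsifier = kit jobs j284003–j284010 and the seat census). Closes NO item.

Setting (`…HiddenStatesSplitRule`): `SymbGood u e` says that the products `∏_{a ∈ u i} L_a(e k)` of GENERIC affine functionals
`L_a(J) = X(none,a) + Σ_{q∈J} X(some q, a)` of the hidden sets form a nonsingular matrix. When the hidden family `{e k}` is a
DOWN-SET of `2^[K]`, the polynomial functions of degree `≤ t` on its `0/1` points have dimension `#{k : |e k| ≤ t}` (standard monomials),
and a necessary condition for `SymbGood u e` is the HEREDITARY CAPACITY inequality

  `DownCapacity u e`:  for every `A ⊆ [h]` and `t`, `#{i : A ⊆ u i, |u i ∖ A| ≤ t} ≤ #{k : |e k| ≤ t}`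

(the rows containing `A`, divided by the generic unit `∏_{a∈A} L_a`, are products of `|u i ∖ A|` functionals; those of degree `≤ t`
live in a space of that dimension). The plain case `A = ∅` does NOT suffice (seat census: `u = {0,1,01,12,23,14,15}` against `B_2` on three
states is singular although all plain capacities hold — the link of coordinate `1` is too big).

* `DownsetCapacitySufficiency` — **CONJECTURE HCAP** (this seat): for injective `u`, injective down-closed `e`, `DownCapacity u e ⇒ SymbGood u e`.
  Evidence: exact numerics, 0 counterexamples in ≈ 6 000 structured instances with `h ≤ 7` (cubes, balls, ball–colex, products, downsets,
  unions; capacity-tight and hub-shaped column families), every singular instance being a capacity violation; kit sweeps at `h = 6, 7, 8`.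
* `mem_range_of_subset_of_threshold` — ball–colex threshold families are down-closed.
* `downCapacity_of_threshold` — for `h ≤ K` EVERY injective column family satisfies `DownCapacity` against a ball–colex threshold family
  (sets of size `≤ t` on `h − |A|` coordinates are at most as many as the hidden sets of size `≤ t`).
* **`ballGood_of_capacitySufficiency`**, **`partitionMinorsHitByVP_of_capacitySufficiency`** — Conjecture HCAP ⇒ Conjecture Q\* (`BallGood h K r u`
  for all injective `u`, `h ≤ K`) ⇒ item 19717 (`b = 6`), by `exists_table_of_symbGood` and `partitionMinorsHitByVP_of_ballGood`.

So the 𝒟-side door of record is reduced, in the kernel, to a statement of independent interest about generic products of affine functions on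
down-set configurations of the cube (the linear-algebraic matroid of Hadamard monomials of a generic basis of a fixed coordinate ring).

WHAT THIS IS NOT: the conjecture is not proved (only its radius-one case, `…HiddenStatesSimplex`); item 19717 stays open; nothing on CPM,
crux 14610 or VP ≠ VNP.
-/

set_option linter.dupNamespace false

namespace Summit.ValiantsHypothesis.ValiantsHypothesis.Theorems.BarrierLever.HiddenStates

open Finset Matrix MvPolynomial

noncomputable section

/-! ## 1. Hereditary capacity and the conjecture -/

/-- **Hereditary degree capacity** of a column family `u` against a hidden family `e` (meaningful when `{e k}` is down-closed, where
`#{k : |e k| ≤ t}` is the dimension of the polynomial functions of degree `≤ t` on the hidden points): for every `A ⊆ [h]` and every `t`,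
the rows containing `A` with at most `t` further coordinates are at most as many as the hidden sets of size `≤ t`. A necessary condition
for `SymbGood u e` in the down-closed case. -/
def DownCapacity {K h r : ℕ} (u : Fin r → Finset (Fin h)) (e : Fin r → Finset (Fin K)) : Prop :=
  ∀ (A : Finset (Fin h)) (t : ℕ),
    (Finset.univ.filter fun i => A ⊆ u i ∧ (u i \ A).card ≤ t).card ≤ (Finset.univ.filter fun k => (e k).card ≤ t).card

/-- **CONJECTURE HCAP (hereditary capacity sufficiency; cell valiant-natproofs, seat val-np-p3 g7).** For an injective column family
`u`, an injective DOWN-CLOSED hidden family `e` and generic affine functionals, the hereditary capacity inequalities already imply that the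
additive matrix `[∏_{a ∈ u i} L_a(e k)]` is nonsingular. (Theorems-side killable conjecture; no assertion. Evidence in the module docstring.) -/
@[conjecture] def DownsetCapacitySufficiency : Prop :=
  ∀ (K h r : ℕ) (u : Fin r → Finset (Fin h)) (e : Fin r → Finset (Fin K)),
    Function.Injective u → Function.Injective e → (∀ k (J : Finset (Fin K)), J ⊆ e k → J ∈ Set.range e) →
      DownCapacity u e → SymbGood u e

/-! ## 2. Ball–colex threshold families are down-closed and have enough capacity -/

section Threshold

variable {K h r : ℕ}

/-- Threshold families for the ball–colex weight are DOWN-CLOSED: a subset of a member is not heavier, hence is a member. -/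
theorem mem_range_of_subset_of_threshold (e : Fin r → Finset (Fin K))
    (hthr : ∀ J, J ∉ Set.range e → ∀ i, ∑ k ∈ e i, ballWt K k < ∑ k ∈ J, ballWt K k)
    (k : Fin r) (J : Finset (Fin K)) (hJ : J ⊆ e k) : J ∈ Set.range e := by
  by_contra hno
  exact absurd (hthr J hno k) (not_lt.mpr (Finset.sum_le_sum_of_subset hJ))

/-- In a ball–colex threshold family containing a set with more than `t` elements, EVERY set of size `≤ t` is a member
(size-major weight: `|S|·2^K + (binary part < 2^K)`). -/
theorem mem_range_of_card_le_of_threshold (e : Fin r → Finset (Fin K))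
    (hthr : ∀ J, J ∉ Set.range e → ∀ i, ∑ k ∈ e i, ballWt K k < ∑ k ∈ J, ballWt K k)
    (k₀ : Fin r) (t : ℕ) (ht : t < (e k₀).card) (S : Finset (Fin K)) (hS : S.card ≤ t) : S ∈ Set.range e := by
  by_contra hno
  have h1 := hthr S hno k₀
  rw [sum_ballWt, sum_ballWt] at h1
  have h2 := sum_two_pow_lt K S
  have h3 : S.card * 2 ^ K + 2 ^ K ≤ (e k₀).card * 2 ^ K := by
    have : (S.card + 1) * 2 ^ K ≤ (e k₀).card * 2 ^ K := Nat.mul_le_mul_right _ (by omega)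
    rw [Nat.add_mul, one_mul] at this
    exact this
  omega

/-- **Capacity of ball–colex threshold families.** If `h ≤ K`, every injective column family on `h` coordinates satisfies the
hereditary capacity inequalities against any ball–colex threshold family on `K` states. -/
theorem downCapacity_of_threshold (hK : h ≤ K) (u : Fin r → Finset (Fin h)) (hu : Function.Injective u)
    (e : Fin r → Finset (Fin K))
    (hthr : ∀ J, J ∉ Set.range e → ∀ i, ∑ k ∈ e i, ballWt K k < ∑ k ∈ J, ballWt K k) : DownCapacity u e := by
  classical
  intro A t
  by_cases hall : ∀ k, (e k).card ≤ t
  · -- every hidden set is small: the right-hand side is everything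
    have : (Finset.univ.filter fun k : Fin r => (e k).card ≤ t) = Finset.univ :=
      Finset.filter_true_of_mem fun k _ => hall k
    rw [this, Finset.card_univ, Fintype.card_fin]
    exact (Finset.card_filter_le _ _).trans (by rw [Finset.card_univ, Fintype.card_fin])
  · push Not at hall
    obtain ⟨k₀, hk₀⟩ := hall
    -- both sides compare with the number of subsets of `Fin K` of size `≤ t`
    set T : Finset (Finset (Fin K)) := Finset.univ.filter fun S => S.card ≤ t with hT
    -- left ≤ |T| : `i ↦ (u i \ A).map castLE` is injective on the rows containing `A`
    have hleft : (Finset.univ.filter fun i => A ⊆ u i ∧ (u i \ A).card ≤ t).card ≤ T.card := by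
      refine Finset.card_le_card_of_injOn (fun i => (u i \ A).map (Fin.castLEEmb hK)) ?_ ?_
      · intro i hi
        rw [Finset.coe_filter, Set.mem_setOf_eq] at hi
        rw [hT, Finset.coe_filter]
        exact ⟨Finset.mem_univ _, by rw [Finset.card_map]; exact hi.2.2⟩
      · intro i hi j hj hij
        rw [Finset.coe_filter, Set.mem_setOf_eq] at hi hj
        have hd : u i \ A = u j \ A := Finset.map_injective (Fin.castLEEmb hK) hij
        apply hu
        rw [← Finset.sdiff_union_of_subset hi.2.1, ← Finset.sdiff_union_of_subset hj.2.1, hd]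
    -- |T| ≤ right : every small set is a member
    have hright : T.card ≤ (Finset.univ.filter fun k : Fin r => (e k).card ≤ t).card := by
      have hmem : ∀ S ∈ T, S ∈ Set.range e := by
        intro S hS
        rw [hT, Finset.mem_filter] at hS
        exact mem_range_of_card_le_of_threshold e hthr k₀ t hk₀ S hS.2
      haveI : Nonempty (Fin r) := ⟨k₀⟩
      choose! g hg using hmem
      refine Finset.card_le_card_of_injOn g ?_ ?_
      · intro S hS
        have hS' : S ∈ T := hS
        rw [Finset.coe_filter]
        refine ⟨Finset.mem_univ _, ?_⟩
        rw [hg S hS']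
        rw [hT, Finset.mem_filter] at hS'
        exact hS'.2
      · intro S hS S' hS' hSS'
        rw [← hg S hS, ← hg S' hS', hSS']
    exact hleft.trans hright

end Threshold

/-! ## 3. The item modulo the capacity conjecture -/

/-- **Conjecture HCAP ⇒ Conjecture Q\*.** Under `DownsetCapacitySufficiency`, every injective column family is `BallGood h K r`
as soon as `h ≤ K`. -/
theorem ballGood_of_capacitySufficiency (H : DownsetCapacitySufficiency) {K h r : ℕ} (hK : h ≤ K)
    (u : Fin r → Finset (Fin h)) (hu : Function.Injective u) : BallGood h K r u := by
  intro e he hthr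
  exact exists_table_of_symbGood u e
    (H K h r u e hu he (fun k J hJ => mem_range_of_subset_of_threshold e hthr k J hJ)
      (downCapacity_of_threshold hK u hu e hthr))

/-- **Item 19717 modulo Conjecture HCAP** (size exponent `b = 6`, `K = h` hidden states). -/
theorem partitionMinorsHitByVP_of_capacitySufficiency (H : DownsetCapacitySufficiency) :
    Summit.ValiantsHypothesis.ValiantsHypothesis.Theses.BarrierLever.PartitionMinorsHitByVP :=
  partitionMinorsHitByVP_of_ballGood 0 fun _ _ _ u hu => ballGood_of_capacitySufficiency H le_rfl u hu

end

end Summit.ValiantsHypothesis.ValiantsHypothesis.Theorems.BarrierLever.HiddenStates
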